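import Summits.QuantumFields.YangMills.Theorems.BalabanUVNodesN11BgProvisoFamilyBelowFloor
import Summits.QuantumFields.YangMills.Theorems.BalabanUVNodesN11NoExpansionAtRecord13CoP
import Literature.MathematicalPhysics.QuantumFieldTheory.Balaban1983to89.Node00.Record13SepCoPH

/-!
# DAG node N11 — THE TRANSPORT (B) DISCHARGED AT THE RECORD: def-R's separated (7)-regular SUPPORT `suppOfRecord₁₃SepCoP` of a dead-topped history lies in that of its truncation
# (`Ω_{k+1}(s) = ∅ ⟹ Supp_{k+1}(s) ⊆ Supp_k(init s)`, every `k`; at length `0` the support is everything), so — with dag-n11-d's `U_{k+1}(s) = U_k(init s)` — the bg-facts family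
# `BgProvisoΛ … m (suppOfRecord₁₃SepCoP … m) (UbgOfRecord₁₃CoP … m)` of a windowed (2.6)-run below the floor asks ONLY (A) the guarded regime, (C) global regularity of the all-small
# histories and (D) the large-field space at switch levels

HEADER — WORK-UNIT METADATA.  Cell `pub-ymgap`, YM-PLAN Track A (HUMAN RULING D-0062 ∕ D-0149 width seats), seat `pub-ymgap-dag-n11-w4` (g5; WIDTH SEAT 4 of 4 on NODE n11
[B14]), route `BalabanUVNodes` rev 29, deciding item K1⁹ `StabilityBRunRowsAtRecordR13SepCoPHV` = stmt-QuantumFields-27364 (helper lane, `--kind proof --supports 27364 --as helper`,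
count-neutral).  [III] = [Balaban1988Convergent], [15] = [Balaban1985Variational], [6] = [Balaban1985RegularSpaces].  Over this seat's `…N11BgProvisoFamilyBelowFloor`
(`bgProvisoΛ_family_of_flowIneq26`: (A)–(D) ⟹ the family), dag-n11-d's `…N11NoExpansionAtRecord13CoP` (`UbgOfRecord₁₃CoP_succ_eq_init_of_Omega_empty`, `…_one_eq_init_…`),
node00's `TkNoExpansionStepSucc` (`genSet_succ_eq_init_of_Omega_empty`, `seq_init_Ω_of_le`), def-R's `LargeFieldBackgroundCoPOfRecord(Faces)` (`regSuppPOfRecord`,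
`suppDomOfRecord_congr`, `suppDomOfRecord_of_Omega_empty`), def-P11's `Record12BgRow{Mixed,TopDomain,Analysis}` (`Sect2.printedPlaqs`, `Sect2.DataSmall7PTop`, `Sect2.SeqSeparated`) and
`Record13SepCoP(H)` (`suppOfRecord₁₃SepCoP`, membership `⟨regular support, separation, (7)-regularity⟩`; row `bg` of `Stage13HParams.Provisos₁₃SepCoPH` — K1⁹'s hypothesis class).

WHY THIS FILE.  `…N11BgProvisoFamilyBelowFloor` derived the whole `hbgs` family below the floor from (A) the guarded regime, (B) def-R's transport along no-expansion tops —
`U_{m+1}(s) = U_m(init s)` AND `Supp_{m+1}(s) ⊆ Supp_m(init s)` when `Ω_{m+1}(s) = ∅` — and the two suppliers (C)/(D); (B) was DISPLAYED.  At the record both halves of (B) are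
THEOREMS: the `U`-half is dag-n11-d's (levels `k ≥ 1`; at `k = 0` pointwise), and the `Supp`-half is proved HERE — every component of the membership `W ∈ suppOfRecord₁₃SepCoP … (k+1) s`
reads the sequence only through `Ω₁` (the support domain `(Ω₁)^{∼M₁}` and its collar), the determining set `{Γ_j}` ((2.2): unchanged along a no-expansion step, node00) and the deeper
regions `Ω_{j+1}`, `j ≤ k` (print's (7) ranges `printedPlaqs`), all of which `init s` shares; the one extra clause of the longer history (level `k+1`, over `Γ_{k+1} = Ω_{k+1} = ∅`) is
simply dropped.  At length `0` (only reached when the floor is `n₀ = 0`) the support of ANY index is all of `MSField` (no small-field region: empty support domain, no level clause), so the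
step `1 → 0` is free.  Net: below the floor the family asks (A), (C), (D) and NOTHING else of def-R's objects.

WHAT THIS FILE PROVES (0 `sorry`, 0 `def`; standard axioms; set bookkeeping on the tree's definitions).  §1 generic (`k ≥ 1`, `Ω_{k+1}(s) = ∅`): `printedPlaqs_succ_eq_init_of_Omega_empty` ·
`regSuppPOfRecord_succ_subset_init_of_Omega_empty` · `seqSeparated_init` · `dataSmall7PTop_init_of_Omega_empty`.  §2 at the record: ★★ `suppOfRecord₁₃SepCoP_succ_subset_init_of_Omega_empty`
(`k ≥ 1`) · `suppOfRecord₁₃SepCoP_zero_eq_univ` · ★★ `suppOfRecord₁₃SepCoP_succ_subset_init_of_Omega_empty'` (every `k`) · `UbgOfRecord₁₃CoP_succ_eq_init_of_Omega_empty'` (every `k`,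
dag-n11-d's two cases joined) · ★★★ `transportB_atRecord` ((B) of `…FamilyBelowFloor`, discharged) · ★★★ `bgProvisoΛ_family_atRecord_of_flowIneq26` (the family at def-R's support and
background of record from (A), (C), (D) alone).  §3 at a `Provisos₁₃SepCoPH` θ (K1⁹'s hypothesis class; `θ.ν.r = 1`, window `]0, γ′]`, `γ′ ≤ θ.γ`): (A) IS row `bg` above the floor (window
restricted, `PartCompat₁₃.of_le`), so ★★★ `bgProvisoΛ_family_atRecord_of_provisos₁₃SepCoPH_of_flowIneq26` — the WHOLE `hbgs` family of a windowed (2.6)-run, every length `m ≤ K`, at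
the record's setting ∕ residual ∕ support ∕ background, from the two analytic suppliers (C) (global regularity of the all-small histories) and (D) (large-field space at switch levels) ALONE.

HONEST FRAMING.  Helper lane of K1⁹; count-neutral; (A) ∕ row `bg`, (C), (D) remain HYPOTHESES (the guarded row P11 ∕ [III] (2.28) ∕ [15] Thm 1 content, asserted by nobody — §3 reads (A)
off the DISPLAYED proviso row `bg`, it does not prove it); (2.6), the window and
`M = L^a`, `r = 1` are the run's letters; nothing of Bałaban asserted; NOT a discharge.  N11 NOT discharged; K1⁹ NOT closed, no registered stub of v9∕v10 touched; counts unmoved (typed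
28∕28 · discharged 5∕27 · A 5∕28).  One finite `𝕋⁴_{L^K}` programme at fixed `ε = L^{−K}`; R4 closes only the conditional finite-𝕋⁴ rung `BalabanLadder.UV` — NOT ℝ⁴, NOT OS, NOT a
mass gap, NOT Clay.  No `sorry`, `axiom`, `def`, `instance`, `notation`.  Sources (SHAPE ∕ bookkeeping only): [III] (2.1)–(2.2) pp.254–255, (2.10)–(2.13) pp.256–257, (2.28) p.259,
(2.6) p.255; [15] (3),(7) p.278; [6] (1.3)–(1.9) p.77.
-/

noncomputable section

open scoped Matrix.Norms.L2Operator

namespace Summit.QuantumFields.YangMills.Theorems.BalabanUVNodesN11BgProvisoFamilyBelowFloorAtRecord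

open Literature.MathematicalPhysics.QuantumFieldTheory.Balaban1983to89 T4Continuum Node00 B14.Eq218Concrete B15DeterminingSets
open BalabanUVNodesN11BgProvisoFamilyBelowFloor (bgProvisoΛ_family_of_flowIneq26)
open BalabanUVNodesN11NoExpansionAtRecord13CoP (UbgOfRecord₁₃CoP_succ_eq_init_of_Omega_empty UbgOfRecord₁₃CoP_one_eq_init_of_Omega_empty)

variable {F : T4Family} {N : ℕ} [NeZero N]

/-! ## §1  Generic: print's (7) ranges, def-R's regular support, separation and (7)-regularity along a no-expansion step `k → k+1` (`k ≥ 1`) -/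

section Generic

variable {ν : Stage7Numerics} {M : ℕ} {g : ℕ → ℝ} {K k : ℕ}

/-- Along a no-expansion step (`k ≥ 1`, `Ω_{k+1}(s) = ∅`) print's (7) plaquette ranges at every level `n ≤ k` are those of the truncation: they read `Γ_n` ((2.2), unchanged — node00's
`genSet_succ_eq_init_of_Omega_empty`) and `Ω_{n+1}` (shared for `n < k`; both `∅` at `n = k`). [cite: Balaban1985Variational, (7) p.278; Balaban1988Convergent, (2.2) p.255 (bookkeeping)] -/
theorem printedPlaqs_succ_eq_init_of_Omega_empty (hk : 1 ≤ k) (s : SeqOfRecord F ν M g K (k + 1)) (hΩ : s.Ω (k + 1) = ∅) {n : ℕ} (hn : n ≤ k) :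
    Sect2.printedPlaqs s.Ω (k + 1) n = Sect2.printedPlaqs s.init.Ω k n := by
  have hΩn : s.init.Ω (n + 1) = s.Ω (n + 1) := by
    rcases hn.lt_or_eq with h | rfl
    · exact seq_init_Ω_of_le s (Nat.succ_le_of_lt h)
    · rw [hΩ, s.init.Ω_off (n + 1) (by omega)]
  unfold Sect2.printedPlaqs Sect2.plaqNoBondIn
  rw [genSet_succ_eq_init_of_Omega_empty hk s hΩ, hΩn]

/-- **def-R's REGULAR SUPPORT ALONG A NO-EXPANSION STEP** (`k ≥ 1`): a datum regular along `s` (collar clause through `Ω₁`, level clauses over `Γ_j`, `1 ≤ j ≤ k+1`) is regular along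
`init s` (the same collar, the same `Γ_j` for `j ≤ k`). [cite: Balaban1988Convergent, (2.10) p.256, (2.2) p.255; Balaban1985Variational, (3),(7) p.278 (bookkeeping)] -/
theorem regSuppPOfRecord_succ_subset_init_of_Omega_empty (hk : 1 ≤ k) (cR : ℝ) (s : SeqOfRecord F ν M g K (k + 1)) (hΩ : s.Ω (k + 1) = ∅) :
    regSuppPOfRecord F N ν M g K (k + 1) cR s ⊆ regSuppPOfRecord F N ν M g K k cR s.init := by
  intro W hW
  rw [mem_regSuppPOfRecord_iff] at hW ⊢
  have h1 : s.init.Ω 1 = s.Ω 1 := seq_init_Ω_of_le s hk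
  refine ⟨?_, fun j hj1 hjk => ?_⟩
  · rw [suppDomOfRecord_congr F ν K h1, h1]
    exact hW.1
  · rw [← genSet_succ_eq_init_of_Omega_empty hk s hΩ]
    exact hW.2 j hj1 (by omega)

/-- Separation ([6] (1.3)–(1.6)) of a history passes to its truncation (the clauses of `init s` are among those of `s`). [cite: Balaban1985RegularSpaces, (1.3)–(1.6) p.77 (bookkeeping)] -/
theorem seqSeparated_init {P : Params} {M₁ : ℕ} {D : ℕ → Set (Set (Site P 0))} {k : ℕ} (s : Seq D (k + 1)) (h : Sect2.SeqSeparated M₁ s) :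
    Sect2.SeqSeparated M₁ s.init := by
  intro n hn1 hnk
  rw [seq_init_Ω_of_le s (show n + 1 ≤ k by omega), seq_init_Ω_of_le s (show n ≤ k by omega)]
  exact h n hn1 (by omega)

/-- **PRINT'S (7)-REGULARITY ALONG A NO-EXPANSION STEP** (`k ≥ 1`, any top domain `Ω₀`): (7) for `s` up to `k+1` gives (7) for `init s` up to `k` — the level-`0` range and every
level-`(m+1)` range and mixed field, `m+1 ≤ k`, coincide (§1's `printedPlaqs_succ_eq_init_of_Omega_empty`, (2.2)); the clause at `m+1 = k+1` is dropped.
[cite: Balaban1985Variational, (7) p.278; Balaban1988Convergent, (2.2) p.255 (bookkeeping)] -/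
theorem dataSmall7PTop_init_of_Omega_empty (hk : 1 ≤ k) (s : SeqOfRecord F ν M g K (k + 1)) (hΩ : s.Ω (k + 1) = ∅)
    {av : ∀ j, Averaging (F.P K) j (SU N)} {Ω₀ : Set (Site (F.P K) 0)} {δ : ℕ → ℝ} {W : MSField (F.P K) (SU N)}
    (h : Sect2.DataSmall7PTop av s.Ω Ω₀ (k + 1) δ W) : Sect2.DataSmall7PTop av s.init.Ω Ω₀ k δ W := by
  refine ⟨?_, fun m hm => ?_⟩
  · unfold Sect2.printedPlaqsTop
    rw [← printedPlaqs_succ_eq_init_of_Omega_empty hk s hΩ (Nat.zero_le k)]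
    exact h.1
  · rw [← printedPlaqs_succ_eq_init_of_Omega_empty hk s hΩ hm, ← genSet_succ_eq_init_of_Omega_empty hk s hΩ]
    exact h.2 m (by omega)

end Generic

/-! ## §2  At the record: def-R's separated (7)-regular support and background along no-expansion tops; the family below the floor from (A), (C), (D) -/

section AtRecord

variable (θ : Stage13Params F N) (p : B12.RunParams)

/-- **★★ def-R's SEPARATED (7)-REGULAR SUPPORT OF RECORD ALONG A NO-EXPANSION TOP, `k ≥ 1`**: `Ω_{k+1}(s) = ∅ ⟹ suppOfRecord₁₃SepCoP θ p (k+1) s ⊆ suppOfRecord₁₃SepCoP θ p k (init s)`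
(regular support, separation and (7)-regularity over the support domain `(Ω₁)^{∼M₁}` — each by §1; the support domain reads `Ω₁` only).
[cite: Balaban1988Convergent, (2.10) p.256, (2.2) p.255, (2.28) p.259; Balaban1985Variational, (3),(7) p.278; Balaban1985RegularSpaces, (1.3)–(1.6) p.77 (bookkeeping)] -/
theorem suppOfRecord₁₃SepCoP_succ_subset_init_of_Omega_empty {k : ℕ} (hk : 1 ≤ k)
    (s : SeqOfRecord F θ.ν θ.τ9.M (gOfRecord₁₃ F N θ p) p.K (k + 1)) (hΩ : s.Ω (k + 1) = ∅) :
    suppOfRecord₁₃SepCoP F N θ p (k + 1) s ⊆ suppOfRecord₁₃SepCoP F N θ p k s.init := by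
  intro W hW
  rw [mem_suppOfRecord₁₃SepCoP_iff] at hW ⊢
  obtain ⟨hreg, hsep, h7⟩ := hW
  have h1 : s.init.Ω 1 = s.Ω 1 := seq_init_Ω_of_le s hk
  refine ⟨regSuppPOfRecord_succ_subset_init_of_Omega_empty hk θ.s2.cR s hΩ hreg, seqSeparated_init s hsep, ?_⟩
  rw [suppDomOfRecord_congr F θ.ν p.K h1]
  exact dataSmall7PTop_init_of_Omega_empty hk s hΩ h7

/-- **AT LENGTH `0` THE SUPPORT OF RECORD IS EVERYTHING**: a length-`0` index has `Ω₁ = ∅`, so the support domain `(Ω₁)^{∼M₁}` is empty (def-R `suppDomOfRecord_of_Omega_empty`), the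
collar and the level-`0` (7) range are empty, and there is no level clause and no separation clause. [cite: Balaban1985Variational, (3),(7) p.278; Balaban1988Convergent, (2.10) p.256 (bookkeeping)] -/
theorem suppOfRecord₁₃SepCoP_zero_eq_univ (t : SeqOfRecord F θ.ν θ.τ9.M (gOfRecord₁₃ F N θ p) p.K 0) :
    suppOfRecord₁₃SepCoP F N θ p 0 t = Set.univ := by
  have h1 : t.Ω 1 = ∅ := t.Ω_off 1 (by omega)
  have hD : suppDomOfRecord F θ.ν p.K t.Ω = ∅ := suppDomOfRecord_of_Omega_empty F θ.ν p.K h1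
  refine Set.eq_univ_of_forall fun W => ?_
  rw [mem_suppOfRecord₁₃SepCoP_iff]
  refine ⟨?_, fun n hn1 hn0 => absurd hn0 (Nat.not_lt_zero n), ?_⟩
  · show W ∈ regSuppPOfRecord F N θ.ν θ.τ9.M (gOfRecord₁₃ F N θ p) p.K 0 θ.s2.cR t
    rw [mem_regSuppPOfRecord_iff]
    refine ⟨?_, fun j hj1 hj0 => absurd hj0 (by omega)⟩
    rw [hD, h1, Set.sdiff_empty, plaqsOf_empty]
    exact plaqSmallOn_empty _ _
  · rw [hD]
    refine ⟨?_, fun m hm => absurd hm (by omega)⟩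
    unfold Sect2.printedPlaqsTop
    rw [plaqsOf_empty, Set.inter_empty]
    exact plaqSmallOn_empty _ _

/-- **★★ … FOR EVERY `k`** (at `k = 0` the target support is everything). [cite: Balaban1988Convergent, (2.10) p.256, (2.28) p.259 (bookkeeping)] -/
theorem suppOfRecord₁₃SepCoP_succ_subset_init_of_Omega_empty' {k : ℕ}
    (s : SeqOfRecord F θ.ν θ.τ9.M (gOfRecord₁₃ F N θ p) p.K (k + 1)) (hΩ : s.Ω (k + 1) = ∅) :
    suppOfRecord₁₃SepCoP F N θ p (k + 1) s ⊆ suppOfRecord₁₃SepCoP F N θ p k s.init := by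
  rcases Nat.eq_zero_or_pos k with rfl | hk
  · rw [suppOfRecord₁₃SepCoP_zero_eq_univ θ p s.init]
    exact Set.subset_univ _
  · exact suppOfRecord₁₃SepCoP_succ_subset_init_of_Omega_empty θ p hk s hΩ

/-- dag-n11-d's two transport theorems for def-R's BACKGROUND of record joined over every `k`: `Ω_{k+1}(s) = ∅ ⟹ U_{k+1}(s) = U_k(init s)` (`k ≥ 1`:
`UbgOfRecord₁₃CoP_succ_eq_init_of_Omega_empty`; `k = 0`: `…_one_eq_init_…` pointwise, here by `funext`). [cite: Balaban1988Convergent, (2.12)–(2.13) pp.256–257 (bookkeeping)] -/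
theorem UbgOfRecord₁₃CoP_succ_eq_init_of_Omega_empty' {k : ℕ}
    (s : SeqOfRecord F θ.ν θ.τ9.M (gOfRecord₁₃ F N θ p) p.K (k + 1)) (hΩ : s.Ω (k + 1) = ∅) :
    UbgOfRecord₁₃CoP F N θ p (k + 1) s = UbgOfRecord₁₃CoP F N θ p k s.init := by
  rcases Nat.eq_zero_or_pos k with rfl | hk
  · funext W
    exact UbgOfRecord₁₃CoP_one_eq_init_of_Omega_empty θ p s hΩ W
  · exact UbgOfRecord₁₃CoP_succ_eq_init_of_Omega_empty θ p hk s hΩ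

/-- **★★★ (B) OF `…N11BgProvisoFamilyBelowFloor` AT THE RECORD, DISCHARGED**: along every no-expansion top of the tail (indeed of ANY length `m < K`), def-R's background and separated
(7)-regular support of record are transported from the truncation. [cite: Balaban1988Convergent, (2.10)–(2.13) pp.256–257, (2.28) p.259 (bookkeeping)] -/
theorem transportB_atRecord (n₀ : ℕ) :
    ∀ m, n₀ ≤ m → m < p.K → ∀ s : SeqOfRecord F θ.ν θ.τ9.M (gOfRecord₁₃ F N θ p) p.K (m + 1), s.Ω (m + 1) = ∅ →
      UbgOfRecord₁₃CoP F N θ p (m + 1) s = UbgOfRecord₁₃CoP F N θ p m s.init ∧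
        suppOfRecord₁₃SepCoP F N θ p (m + 1) s ⊆ suppOfRecord₁₃SepCoP F N θ p m s.init :=
  fun _ _ _ s hΩ => ⟨UbgOfRecord₁₃CoP_succ_eq_init_of_Omega_empty' θ p s hΩ, suppOfRecord₁₃SepCoP_succ_subset_init_of_Omega_empty' θ p s hΩ⟩

variable {𝔸 : Type*} [NormedRing 𝔸] [NormedAlgebra ℂ 𝔸] [CompleteSpace 𝔸] {S : Sect2.Setting 𝔸 (SU N)}

/-- **★★★ THE bg-FACTS FAMILY OF A (2.6)-RUN BELOW THE FLOOR AT def-R's SUPPORT AND BACKGROUND OF RECORD, FROM (A), (C), (D) ALONE** (generic θ, `θ.τ9.M = F.L^a`, `θ.ν.r = 1`, window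
`]0, γ]`, (2.6) with `0 ≤ β⁺`, `β⁺·γ² ≤ 1`; any setting `S` and residual `Rz`): `…FamilyBelowFloor`'s `bgProvisoΛ_family_of_flowIneq26` at `Supp m := suppOfRecord₁₃SepCoP θ p m`,
`U m := UbgOfRecord₁₃CoP θ p m`, its transport input (B) supplied by `transportB_atRecord`.  The supplier side is handed p633302's last compatible level `n₀` (`PartCompat₁₃ θ p n₀`, one-block
tail) and returns (A) the token of every length `m ≤ n₀`, (C) `spaceI` on every domain at the all-small levels of the tail families, (D) `spaceMS` at their switch levels.
[cite: Balaban1988Convergent, (2.6) p.255, (2.1)–(2.3) pp.254–255, (2.10)–(2.13) pp.256–257, (2.27)–(2.28) p.259, (2.41)(i) p.261] -/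
theorem bgProvisoΛ_family_atRecord_of_flowIneq26 {a : ℕ} (hMa : θ.τ9.M = F.L ^ a) (hr : θ.ν.r = 1)
    {γ βup β₀ : ℝ} (hβ : 0 ≤ βup) (hβγ : βup * γ ^ 2 ≤ 1)
    (hW : Step.InInterval γ p.K (gOfRecord₁₃ F N θ p))
    (h26 : B14.FlowIneq26 (gOfRecord₁₃ F N θ p) βup β₀ p.K)
    {Rz : Sect2.Residual (F.P p.K) 𝔸}
    (hsupply : ∀ n₀, n₀ ≤ p.K → PartCompat₁₃ F N θ p n₀ →
      (∀ j, n₀ < j → j ≤ p.K → (F.P p.K).sitesPerDir 0 < dCubeSide (F.P p.K).L θ.τ9.M (RkOfRecord (F.P p.K).L θ.ν.r (gOfRecord₁₃ F N θ p j)) j) →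
      -- (A) the guarded regime: every length `m ≤ n₀`
      (∀ m, m ≤ n₀ → BgProvisoΛ F N p.K S Rz θ.τ9.M m (suppOfRecord₁₃SepCoP F N θ p m) (UbgOfRecord₁₃CoP F N θ p m)) ∧
      -- (C) global regularity of the all-small histories
      (∀ m, n₀ < m → m ≤ p.K → ∀ (s : SeqOfRecord F θ.ν θ.τ9.M (gOfRecord₁₃ F N θ p) p.K m) (W : MSField (F.P p.K) (SU N)),
        W ∈ suppOfRecord₁₃SepCoP F N θ p m s →
        ∀ j, 1 ≤ j → j ≤ m → (∀ i, 1 ≤ i → i ≤ j → s.Ω i = Set.univ ∧ s.Λ i = Set.univ) → ∀ X : (Sect2.domSys (F.P p.K) θ.τ9.M j).Dom,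
          Sect2.ofBackgroundC S.ι (UbgOfRecord₁₃CoP F N θ p m s W) ∈
            Sect2.spaceI S Rz θ.τ9.M j (Sect2.domSites (F.P p.K) θ.τ9.M j X) (S.lf.alpha0 (S.flow.g j)) (S.lf.alpha1 (S.flow.g j))) ∧
      -- (D) the large-field space at switch levels
      (∀ m, n₀ < m → m ≤ p.K → ∀ (s : SeqOfRecord F θ.ν θ.τ9.M (gOfRecord₁₃ F N θ p) p.K m) (W : MSField (F.P p.K) (SU N)),
        W ∈ suppOfRecord₁₃SepCoP F N θ p m s →
        ∀ j, n₀ < j → j ≤ m → (∀ i, 1 ≤ i → i < j → s.Ω i = Set.univ ∧ s.Λ i = Set.univ) → s.Ω j = Set.univ → s.Λ j = ∅ →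
          (∀ i, j < i → i ≤ m → s.Ω i = ∅ ∧ s.Λ i = ∅) → ∀ X : (Sect2.domSys (F.P p.K) θ.τ9.M j).Dom,
            Sect2.ofBackgroundC S.ι (UbgOfRecord₁₃CoP F N θ p m s W) ∈ Sect2.spaceMS S Rz θ.τ9.M j (Sect2.domSites (F.P p.K) θ.τ9.M j X) s.Ω)) :
    ∀ m, m ≤ p.K → BgProvisoΛ F N p.K S Rz θ.τ9.M m (suppOfRecord₁₃SepCoP F N θ p m) (UbgOfRecord₁₃CoP F N θ p m) :=
  bgProvisoΛ_family_of_flowIneq26 θ hMa hr p hβ hβγ hW h26 (suppOfRecord₁₃SepCoP F N θ p) (UbgOfRecord₁₃CoP F N θ p)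
    fun n₀ hn₀ hPC htail =>
      have h := hsupply n₀ hn₀ hPC htail
      ⟨h.1, transportB_atRecord θ p n₀, h.2.1, h.2.2⟩

end AtRecord

/-! ## §3  At a `Provisos₁₃SepCoPH` θ (K1⁹'s hypothesis class): (A) is row `bg` above the floor — the whole family from (C), (D) alone -/

section AtProvisos

variable (θ : Stage13HParams F N) (p : B12.RunParams)

/-- **★★★ THE WHOLE bg-FACTS FAMILY OF A WINDOWED (2.6)-RUN AT A `Provisos₁₃SepCoPH` θ, FROM THE TWO ANALYTIC SUPPLIERS ALONE** (`θ.ν.r = 1`; `M = L^a` is the proviso letter `hM`;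
window `]0, γ′]` up to `K` with `γ′ ≤ θ.γ` — dag-n11-w1's letters; (2.6) with `0 ≤ β⁺`, `β⁺·γ′² ≤ 1`): above the floor (lengths `m ≤ n₀`, `PartCompat₁₃ θ p n₀` from p633302's split, restricted by `PartCompat₁₃.of_le`, the window
restricted to `m`) input (A) IS the displayed row `bg`; the transport (B) is §2's theorem; so the family `BgProvisoΛ … m (suppOfRecord₁₃SepCoP θ p m) (UbgOfRecord₁₃CoP θ p m)`, EVERY `m ≤ K`, at the
record's setting `settingOfRecord₁₃ θ p` and residual `θ.Rz K`, follows from (C) `spaceI` on every domain at the all-small levels of the tail families and (D) `spaceMS` at their switch levels —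
nothing else.  (Row `bg` is a HYPOTHESIS of the class, read here, not proved.) [cite: Balaban1988Convergent, (2.6) p.255, (2.1)–(2.3) pp.254–255, (2.10)–(2.13) pp.256–257, (2.27)–(2.28) p.259,
(2.41)(i) p.261, p.257] -/
theorem bgProvisoΛ_family_atRecord_of_provisos₁₃SepCoPH_of_flowIneq26 (hθ : θ.Provisos₁₃SepCoPH F N) (hr : θ.ν.r = 1)
    {γ' βup β₀ : ℝ} (hβ : 0 ≤ βup) (hβγ : βup * γ' ^ 2 ≤ 1) (hγ' : γ' ≤ θ.γ)
    (hW : Step.InInterval γ' p.K (gOfRecord₁₃ F N θ.toStage13Params p))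
    (h26 : B14.FlowIneq26 (gOfRecord₁₃ F N θ.toStage13Params p) βup β₀ p.K)
    (hsupply : ∀ n₀, n₀ ≤ p.K → PartCompat₁₃ F N θ.toStage13Params p n₀ →
      (∀ j, n₀ < j → j ≤ p.K →
        (F.P p.K).sitesPerDir 0 < dCubeSide (F.P p.K).L θ.τ9.M (RkOfRecord (F.P p.K).L θ.ν.r (gOfRecord₁₃ F N θ.toStage13Params p j)) j) →
      -- (C) global regularity of the all-small histories
      (∀ m, n₀ < m → m ≤ p.K → ∀ (s : SeqOfRecord F θ.ν θ.τ9.M (gOfRecord₁₃ F N θ.toStage13Params p) p.K m) (W : MSField (F.P p.K) (SU N)),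
        W ∈ suppOfRecord₁₃SepCoP F N θ.toStage13Params p m s →
        ∀ j, 1 ≤ j → j ≤ m → (∀ i, 1 ≤ i → i ≤ j → s.Ω i = Set.univ ∧ s.Λ i = Set.univ) → ∀ X : (Sect2.domSys (F.P p.K) θ.τ9.M j).Dom,
          Sect2.ofBackgroundC (settingOfRecord₁₃ F N θ.toStage13Params p).ι (UbgOfRecord₁₃CoP F N θ.toStage13Params p m s W) ∈
            Sect2.spaceI (settingOfRecord₁₃ F N θ.toStage13Params p) (θ.Rz p.K) θ.τ9.M j (Sect2.domSites (F.P p.K) θ.τ9.M j X)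
              ((settingOfRecord₁₃ F N θ.toStage13Params p).lf.alpha0 ((settingOfRecord₁₃ F N θ.toStage13Params p).flow.g j))
              ((settingOfRecord₁₃ F N θ.toStage13Params p).lf.alpha1 ((settingOfRecord₁₃ F N θ.toStage13Params p).flow.g j))) ∧
      -- (D) the large-field space at switch levels
      (∀ m, n₀ < m → m ≤ p.K → ∀ (s : SeqOfRecord F θ.ν θ.τ9.M (gOfRecord₁₃ F N θ.toStage13Params p) p.K m) (W : MSField (F.P p.K) (SU N)),
        W ∈ suppOfRecord₁₃SepCoP F N θ.toStage13Params p m s →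
        ∀ j, n₀ < j → j ≤ m → (∀ i, 1 ≤ i → i < j → s.Ω i = Set.univ ∧ s.Λ i = Set.univ) → s.Ω j = Set.univ → s.Λ j = ∅ →
          (∀ i, j < i → i ≤ m → s.Ω i = ∅ ∧ s.Λ i = ∅) → ∀ X : (Sect2.domSys (F.P p.K) θ.τ9.M j).Dom,
            Sect2.ofBackgroundC (settingOfRecord₁₃ F N θ.toStage13Params p).ι (UbgOfRecord₁₃CoP F N θ.toStage13Params p m s W) ∈
              Sect2.spaceMS (settingOfRecord₁₃ F N θ.toStage13Params p) (θ.Rz p.K) θ.τ9.M j (Sect2.domSites (F.P p.K) θ.τ9.M j X) s.Ω)) :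
    ∀ m, m ≤ p.K → BgProvisoΛ F N p.K (settingOfRecord₁₃ F N θ.toStage13Params p) (θ.Rz p.K) θ.τ9.M m
      (suppOfRecord₁₃SepCoP F N θ.toStage13Params p m) (UbgOfRecord₁₃CoP F N θ.toStage13Params p m) := by
  obtain ⟨a, hMa⟩ := hθ.hM
  exact bgProvisoΛ_family_atRecord_of_flowIneq26 θ.toStage13Params p hMa hr hβ hβγ hW h26 fun n₀ hn₀ hPC htail =>
    ⟨fun m hm => hθ.bg p m (hm.trans hn₀)
        (fun k hk => ⟨(hW k (hk.trans (hm.trans hn₀))).1, (hW k (hk.trans (hm.trans hn₀))).2.trans hγ'⟩) (hPC.of_le hm),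
      hsupply n₀ hn₀ hPC htail⟩

end AtProvisos

end Summit.QuantumFields.YangMills.Theorems.BalabanUVNodesN11BgProvisoFamilyBelowFloorAtRecord

end
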